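import Summits.BirchSwinnertonDyer.BirchSwinnertonDyer.Theorems.ErratumRoadFiveNonSurjCornerKolyJProp44StandingInputs
import Summits.BirchSwinnertonDyer.BirchSwinnertonDyer.Theorems.ClassRecordThreeEulerHalvesAtThreeWalkCompatData
import HarnessLib

/-!
# The walk's `h47` (based ordered family, Jetchev Prop. 4.7) DISCHARGED ON THE IRREDUCIBLE CORNER modulo the
# congruence (γ) alone — tam3's `Koly.exists_data_h47Base_of_prop44` with the typed print fact (tower surjectivity,
# ¬CM) REPLACED by `Prop44.addOrderOf_localization_kolyvaginClass_mul_eq_of_congruence_of_irr` (cell `bsd-stepL`,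
# seat `bsd-stepL-corner-p1` g10; `--supports stmt-BirchSwinnertonDyer-19947`; memo CORNER-G10 §1–§2)

WHY/WHAT. The §6 walk of the corner (`stub_kolyJ_max` of 19947; reading of record
`Koly.nonSurjCornerKolyJ_max_of_levelOneSupply_of_perLevel`, memo CORNER-G7 §1 ∕ CORNER-G9 §1) and of 19109
(`stub_jetchevMaxHLAtThree`) consumes the input `h47 : addOrderOf (loc_λ c_k(sℓ)) = addOrderOf (loc_λ c_k(s))` for a
based family of data; tam3 discharged it (`exists_data_h47Base_of_prop44`, …WalkCompatData, p5xxxxx) from the typed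
PRINT fact `McCallum1991.prop44_localOrder_kolyvaginClass_mul_eq`, whose `p`-adic tower-surjectivity binder is void on
the ¬Surj corner. Here the SAME statement and the SAME construction (bsd-jet's `Walk.exists_basedFamily_of_primeStep`
over `exists_compatible_data_of_grossCM`: Gross's one system of choices) with the comparison supplied by the KERNEL
theorem `Prop44.addOrderOf_localization_kolyvaginClass_mul_eq_of_congruence_of_irr` (…Prop44StandingInputs): the
hypotheses become `E[p]` IRREDUCIBLE (no surjectivity, no ¬CM), `p` split in `K` (corner frames), and (γ) = Gross
1991 Prop. 3.7 (2) in PAIR form for `(W, K)` — the binder `hγW`, whose text is the body of the §3-only reading of the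
printed proposition (image-free, `p`-free; Nekovář 2007 Prop. 4.13 (ii) prints the same congruence with no image
hypothesis). HONEST FRAMING: `h47` for the corner walk ⟸ ONE print input (γ); nothing about BSD; no stub closes; T7.
References: [McCallumLMS1991] §4 Prop. 4.4 (p. 301); [GrossLMS1991] §3 (pp. 238–241), Prop. 3.7 (2), §4 (4.1);
[Jetchev2008] Prop. 4.4 (p. 821) = arXiv Prop. 4.7; [Nekovar2007] Prop. 4.13 (ii).
-/

set_option autoImplicit false
set_option linter.dupNamespace false

noncomputable section

open scoped Classical

namespace Summit.BirchSwinnertonDyer.BirchSwinnertonDyer.Theorems.Prop44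

open WeierstrassCurve IsDedekindDomain NumberField Field Literature.NumberTheory.EllipticCurves
  Literature.NumberTheory.EllipticCurves.ModularForms Literature.NumberTheory.GaloisRepresentations
  Literature.NumberTheory.EllipticCurves.KolyvaginCocycle
  Summit.BirchSwinnertonDyer.Rank1Residual.JET Summit.BirchSwinnertonDyer.Rank1Residual.X11b.Three.Koly

/-- **`h47` of the based ordered walk on the IRREDUCIBLE cell, modulo (γ).** For `E = W/ℚ` globally minimal of conductor
`N_E`, `K` imaginary quadratic with `d_K < −4`, the Heegner hypothesis for `N_E`, an odd prime `p` split in `K`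
(`SatisfiesHeegnerHypothesis p K`) with `E[p]` IRREDUCIBLE, the congruence (γ) = Gross Prop. 3.7 (2) in pair form for
`(W, K)` (`hγW`), a frame `(Dt, β, ι)`, a level `p^k` (`k ≥ 1`) and ANY datum `d` at an admissible conductor `n`:
there is a data system `D` on the admissible-conductor subtype with `D n = d` such that along every based ordered
prime step `s ↦ sℓ` the localisations at `λ ∋ ℓ` of `c_k(sℓ)` and `c_k(s)` have the same order — the statement of
tam3's `Koly.exists_data_h47Base_of_prop44` VERBATIM but for its hypotheses (`h44` print fact + `¬CM` + tower ↦ `hγW`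
+ `hirr` + `hHp`). [cite: McCallumLMS1991, §4 Prop. 4.4 (p. 301)] [cite: GrossLMS1991, Prop. 3.7 (2), §3
(pp. 238–239), §4 (4.1)] [cite: Jetchev2008, Prop. 4.4 (p. 821)] [cite: Nekovar2007, Prop. 4.13 (ii)] -/
theorem exists_data_h47Base_of_congruence_of_irr
    (W : WeierstrassCurve ℚ) [W.IsElliptic] [W.IsGloballyMinimal] [NeZero (W.conductorNorm ℤ)]
    {K : Type} [Field K] [NumberField K] (hK : IsImaginaryQuadratic K)
    (hD : NumberField.discr K < -4) (hH : SatisfiesHeegnerHypothesis (W.conductorNorm ℤ) K)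
    {p : ℕ} [Fact p.Prime] (hp2 : p ≠ 2) (hHp : SatisfiesHeegnerHypothesis p K)
    (hirr : W.HasIrreducibleModPGaloisRep p)
    (hγW : ∀ (Dt : ModularParametrizationData W (W.conductorNorm ℤ)) (β : ℤ) (ι : K →+* ℂ)
      (m ℓ : ℕ), Squarefree (m * ℓ) → ℓ.Prime → ¬ ℓ ∣ m →
      (∀ q ∈ (m * ℓ).primeFactors, ¬ q ∣ W.conductorNorm ℤ) →
      ¬ ((ℓ : ℤ) ∣ NumberField.discr K) → (Ideal.span {(ℓ : 𝓞 K)}).IsPrime →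
      ∀ (d' : KolyvaginHeegnerData Dt β ι (m * ℓ)) (d : KolyvaginHeegnerData Dt β ι m)
        [Fact ℓ.Prime] (hΔ : ¬ (ℓ : ℤ) ∣ minimalDiscriminantInt W) (φ₀ : absoluteGaloisGroup (ZMod ℓ)),
        (∀ x : AlgebraicClosure (ZMod ℓ), φ₀ • x = x ^ ℓ) →
        ∀ (hle : ringClassField K ι m ≤ ringClassField K ι (m * ℓ))
          (γ : ringClassField K ι (m * ℓ) ≃ₐ[ℚ] ringClassField K ι (m * ℓ)), γ ∈ ringClassGal ι (m * ℓ) →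
          geomReduction hΔ ((RatClosure.pointsEquiv (K := K) W).symm
              (d'.toGeomPoints (pointGalHom W (ringClassField K ι (m * ℓ)) γ d'.y))) =
            φ₀ • geomReduction hΔ ((RatClosure.pointsEquiv (K := K) W).symm
              (d'.toGeomPoints (pointGalHom W (ringClassField K ι (m * ℓ)) γ
                (WeierstrassCurve.Affine.Point.map (W' := W)
                  (letI : Algebra K ℂ := ι.toAlgebra; (RingClassField.inclusion ι hle).restrictScalars ℚ)
                  d.y)))))
    (Dt : ModularParametrizationData W (W.conductorNorm ℤ)) (β : ℤ) (ι : K →+* ℂ) {k : ℕ} (hk : 1 ≤ k)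
    {n : ℕ} (hn : Squarefree n ∧ ∀ q ∈ n.primeFactors,
      Zhang2014.IsKolyvaginPrime (W.conductorNorm ℤ) W K p q ∧ k ≤ Zhang2014.kolyvaginIndex W p q)
    (d : KolyvaginHeegnerData Dt β ι n) :
    ∃ D : ∀ s : {m : ℕ // Squarefree m ∧ ∀ q ∈ m.primeFactors,
        Zhang2014.IsKolyvaginPrime (W.conductorNorm ℤ) W K p q ∧ k ≤ Zhang2014.kolyvaginIndex W p q},
        KolyvaginHeegnerData Dt β ι s.1, D ⟨n, hn⟩ = d ∧
      ∀ (s s' : {m : ℕ // Squarefree m ∧ ∀ q ∈ m.primeFactors,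
        Zhang2014.IsKolyvaginPrime (W.conductorNorm ℤ) W K p q ∧ k ≤ Zhang2014.kolyvaginIndex W p q})
        (ℓ : ℕ), ℓ.Prime → ¬ ℓ ∣ s.1 → s'.1 = s.1 * ℓ → (∀ q ∈ s.1.primeFactors, q < ℓ) → n ∣ s.1 →
      ∀ v : HeightOneSpectrum (𝓞 K), (ℓ : 𝓞 K) ∈ v.asIdeal →
      addOrderOf (galoisCohomology.localization ((W.baseChange K).torsionGaloisModule ((p ^ k : ℕ) : ℤ))
          (Sum.inr v) 1 ((D s').kolyvaginClass (Fact.out : p.Prime) k)) =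
        addOrderOf (galoisCohomology.localization ((W.baseChange K).torsionGaloisModule ((p ^ k : ℕ) : ℤ))
          (Sum.inr v) 1 ((D s).kolyvaginClass (Fact.out : p.Prime) k)) := by
  haveI : ∀ j : ℕ, NumberField (ringClassField K ι j) := numberField_ringClassField K hK ι
  have hD3 : NumberField.discr K ≠ -3 := by omega
  have hD4 : NumberField.discr K ≠ -4 := by omega
  -- the based family of compatible data (Gross's one system of choices), exactly as in tam3's construction
  obtain ⟨D, hDn, hR⟩ := Walk.exists_basedFamily_of_primeStep
    (data := fun m ↦ KolyvaginHeegnerData Dt β ι m)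
    (fun m ↦ Squarefree m ∧ ∀ q ∈ m.primeFactors,
      Zhang2014.IsKolyvaginPrime (W.conductorNorm ℤ) W K p q ∧ k ≤ Zhang2014.kolyvaginIndex W p q)
    (R := fun {a b} (dc : KolyvaginHeegnerData Dt β ι a) (d' : KolyvaginHeegnerData Dt β ι b) ↦
      (∀ l' ∈ a.primeFactors, ∀ (x : ringClassField K ι a) (x' : ringClassField K ι b),
        (x : ℂ) = x' → ((d'.σ l' x' : ringClassField K ι b) : ℂ) = (dc.σ l' x : ℂ)) ∧
      (∀ t ∈ dc.S, ∃ t' ∈ d'.S, ∀ (x : ringClassField K ι a) (x' : ringClassField K ι b),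
        (x : ℂ) = x' → ((t' x' : ringClassField K ι b) : ℂ) = (t x : ℂ)) ∧
      (∀ t' ∈ d'.S, ∃ t ∈ dc.S, ∀ (x : ringClassField K ι a) (x' : ringClassField K ι b),
        (x : ℂ) = x' → ((t' x' : ringClassField K ι b) : ℂ) = (t x : ℂ)) ∧
      (∀ (x : ringClassField K ι a) (x' : ringClassField K ι b),
        (x : ℂ) = x' → d'.emb x' = dc.emb x))
    (fun m h ↦ h.1) (fun m m' h hm' ↦ ⟨h.1.squarefree_of_dvd hm', fun q hq ↦
      h.2 q (Nat.primeFactors_mono hm' h.1.ne_zero hq)⟩)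
    (fun m h ↦ BirchSwinnertonDyer.Theorems.nonempty_kolyvaginHeegnerData_of_grossCM
      (phi_heegnerPointOfConductor_mem_range_map_ringClassField_holds _ W K)
      exists_generator_ringClassGalOver_holds hK hH Dt β ι d.dvd_sq_sub h.1
      (fun q hq ↦ (h.2 q hq).1.2.2.2.2.1))
    (fun c ℓ dc hA hℓ ↦ by
      have hc0 : c * ℓ ≠ 0 := hA.1.ne_zero
      obtain ⟨hcop, hc, -⟩ := Nat.squarefree_mul_iff.mp hA.1
      have hcK : ∀ q ∈ c.primeFactors, Zhang2014.IsKolyvaginPrime (W.conductorNorm ℤ) W K p q :=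
        fun q hq ↦ (hA.2 q (Nat.primeFactors_mono (dvd_mul_right c ℓ) hc0 hq)).1
      have hKol : Zhang2014.IsKolyvaginPrime (W.conductorNorm ℤ) W K p ℓ :=
        (hA.2 ℓ (Nat.mem_primeFactors.mpr ⟨hℓ, dvd_mul_left ℓ c, hc0⟩)).1
      have hℓc : ℓ ∉ c.primeFactors := fun h ↦
        (Nat.Prime.coprime_iff_not_dvd hℓ).mp hcop.symm (Nat.dvd_of_mem_primeFactors h)
      obtain ⟨dℓ, hdℓ⟩ := exists_compatible_data_of_grossCM
        (phi_heegnerPointOfConductor_mem_range_map_ringClassField_holds _ W K) hK hD hH p Dt β ι hc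
        hcK dc
      exact ⟨dℓ ℓ hKol hℓc, hdℓ ℓ hKol hℓc⟩)
    hn d
  refine ⟨D, hDn, ?_⟩
  intro s s' ℓ hℓ hℓs hs' hlt hns v hv
  obtain ⟨hσ, hS1, hS2, hemb⟩ := hR s s' ℓ hℓ hℓs hs' hlt hns
  -- transport the datum at `s'` along `s'.1 = s.1 * ℓ`
  obtain ⟨m', hm'⟩ := s'
  change m' = s.1 * ℓ at hs'
  subst hs'
  -- (γ) for the pair, from `hγW` (the prime factors of `s·ℓ` are Zhang–Kolyvagin: `∤ N_E`; `ℓ` inert, `∤ d_K`)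
  have hs0 : s.1 * ℓ ≠ 0 := hm'.1.ne_zero
  have hKol : Zhang2014.IsKolyvaginPrime (W.conductorNorm ℤ) W K p ℓ :=
    (hm'.2 ℓ (Nat.mem_primeFactors.mpr ⟨hℓ, dvd_mul_left ℓ s.1, hs0⟩)).1
  haveI : Fact ℓ.Prime := ⟨hℓ⟩
  have hγ := hγW Dt β ι s.1 ℓ hm'.1 hℓ hℓs (fun q hq ↦ (hm'.2 q hq).1.2.1) hKol.2.2.1 hKol.2.2.2.2.1
    (D ⟨s.1 * ℓ, hm'⟩) (D s)
  exact addOrderOf_localization_kolyvaginClass_mul_eq_of_congruence_of_irr hK hD3 hD4 hH hp2 hHp hirr Dt β ι k hk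
    s.1 ℓ hm'.1 hℓ hℓs hm'.2 (D s) (D ⟨s.1 * ℓ, hm'⟩) hσ hS1 hS2 hemb
    (fun hΔ φ₀ hφ₀ hle γ hγ' ↦ hγ hΔ φ₀ hφ₀ hle γ hγ') v hv

end Summit.BirchSwinnertonDyer.BirchSwinnertonDyer.Theorems.Prop44

end
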